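import Summits.BirchSwinnertonDyer.BirchSwinnertonDyer.Theorems.Rank2ObservatoryRank3PSatCertCL
import HarnessLib

/-!
# BirchSwinnertonDyer — rank ≥ 2 observatory: `p`-saturation certificates, SHALLOW kernel form

HONEST FRAMING: per-curve certified theorems and census instruments; no claim on BSD in rank ≥ 2.

The fast dense row Boolean `rank3PSatCheckCL` (`Rank2ObservatoryRank3PSatCertCL`, counts by
`killerLB`) evaluates, per witness prime `q`, two structural recursions of DEPTH `q` in the kernel:
the count `legendreCountAux … q` (`aux (x+1) = aux x + e x`, the sum is demanded before the
addition reduces) and the primality test `decide q.Prime` (Mathlib's `Nat.decidablePrime`, a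
`∀ m < q` recursion).  At `p = 3` the witness primes stay `≤ 179`; at `p = 5` and `p = 7` they reach
`367` and `599`, and the gate's kernel thread rejects windows whose largest prime is `≥ 233`
(cert-2 gen 35, p587568: window with `q = 233` rejected, `q = 227` accepted; the same file
elaborates on the check farm) — a recursion-DEPTH artefact, not a mathematical one.  This file
replaces ONLY those two evaluations by recursion of bounded depth, with the same values:

* `trialDivB` / `primeTDB` — trial division `k = 2, 3, …` while `k² ≤ q`, short-circuit `&&`
  (depth `O(1)` per step in the kernel's weak-head loop), and `prime_of_primeTDB`
  (`Nat.prime_def_le_sqrt`);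
* `legendreCountTR` — the same sum with an accumulator FORCED at every step by a `match` on its
  successor form (the kernel binds the predecessor literal), `legendreCountTR_eq`;
  `legendrePointCountTR`, `legendrePointCountTR_eq`;
* `goodPrimeTB`, `killerLTB` with `killerLB_of_killerLTB` / `all_killerLB_of_all_killerLTB`;
* the row Boolean `rank3PSatCheckCLT` (= `rank3PSatCheckCL` with `killerLTB` on `S` and `Q`),
  `rank3PSatCheckCL_of_checkCLT`, `Rank3Row.pSaturated_of_pSatCheckCLT`, and the list form
  `rank3PSatCheckCLTAll`, `rank3PSatCheckCLAll_of_checkCLTAll`,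
  `Rank3Row.pSaturated_of_pSatCheckCLTAll` — the statement the `p = 5, 7` data files cite.

The row DATUM `Rank3PSatCertC` is unchanged (staged literals reusable verbatim).  Sorry-free; no
`decide` executed in this file.

References: J. E. Cremona, *Algorithms for Modular Elliptic Curves* (1997) §2.4, §3.5; S. Siksek,
Rocky Mountain J. Math. 25 (1995) §3.
-/

-- single-conjunct summit: `Summit.BirchSwinnertonDyer.BirchSwinnertonDyer.…` repeats the name
set_option linter.dupNamespace false

namespace Summit.BirchSwinnertonDyer.BirchSwinnertonDyer.Rank2Observatory

open WeierstrassCurve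

/-! ### Shallow primality by trial division -/

/-- Trial division from `k` with `fuel` steps: `true` as soon as `q < k²`; `false` if `k ∣ q` or the
fuel runs out. [folklore] -/
def trialDivB (q : ℕ) : ℕ → ℕ → Bool
  | 0, _ => false
  | fuel + 1, k => if q < k * k then true else !(q % k == 0) && trialDivB q fuel (k + 1)

/-- Shallow primality Boolean: `2 ≤ q` and no divisor `k` with `2 ≤ k`, `k² ≤ q`. [folklore] -/
def primeTDB (q : ℕ) : Bool :=
  decide (2 ≤ q) && trialDivB q q 2

/-- Soundness of the trial-division loop: no divisor `m` with `k ≤ m`, `m² ≤ q`. [folklore] -/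
theorem not_dvd_of_trialDivB (q : ℕ) :
    ∀ (fuel k : ℕ), trialDivB q fuel k = true → ∀ m, k ≤ m → m * m ≤ q → ¬ m ∣ q
  | 0, k, h => by simp [trialDivB] at h
  | fuel + 1, k, h => by
    intro m hkm hmm
    rw [trialDivB] at h
    by_cases hlt : q < k * k
    · exact absurd (lt_of_lt_of_le hlt (Nat.mul_le_mul hkm hkm)) (not_lt.2 hmm)
    · rw [if_neg hlt, Bool.and_eq_true, Bool.not_eq_true', beq_eq_false_iff_ne] at h
      rcases Nat.eq_or_lt_of_le hkm with rfl | hlt'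
      · intro hd
        exact h.1 (Nat.mod_eq_zero_of_dvd hd)
      · exact not_dvd_of_trialDivB q fuel (k + 1) h.2 m hlt' hmm

/-- **`primeTDB q = true ⇒ q` is prime** (`Nat.prime_def_le_sqrt`). [folklore] -/
theorem prime_of_primeTDB {q : ℕ} (h : primeTDB q = true) : q.Prime := by
  rw [primeTDB, Bool.and_eq_true, decide_eq_true_eq] at h
  refine Nat.prime_def_le_sqrt.2 ⟨h.1, fun m hm2 hms => ?_⟩
  exact not_dvd_of_trialDivB q q 2 h.2 m hm2 (Nat.le_sqrt.1 hms)

/-! ### Shallow point count -/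

/-- `acc + ∑_{x < n} eulerSqrtCount q (D(x))`, the accumulator forced to a literal at every step
(the `match` makes the kernel evaluate it before recursing). [cite: CremonaAlgorithms1997, §2.4] -/
def legendreCountTR (q a₁ a₂ a₃ a₄ a₆ : ℕ) : ℕ → ℕ → ℕ
  | 0, acc => acc
  | x + 1, acc =>
    match acc + eulerSqrtCount q (discY q a₁ a₂ a₃ a₄ a₆ x) with
    | 0 => legendreCountTR q a₁ a₂ a₃ a₄ a₆ x 0
    | n + 1 => legendreCountTR q a₁ a₂ a₃ a₄ a₆ x (n + 1)

/-- The forcing `match` is the identity. [folklore] -/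
theorem legendreCountTR_succ (q a₁ a₂ a₃ a₄ a₆ x acc : ℕ) :
    legendreCountTR q a₁ a₂ a₃ a₄ a₆ (x + 1) acc =
      legendreCountTR q a₁ a₂ a₃ a₄ a₆ x (acc + eulerSqrtCount q (discY q a₁ a₂ a₃ a₄ a₆ x)) := by
  rw [legendreCountTR]
  cases acc + eulerSqrtCount q (discY q a₁ a₂ a₃ a₄ a₆ x) <;> rfl

/-- The shallow count is the structural count plus the accumulator. [folklore] -/
theorem legendreCountTR_eq (q a₁ a₂ a₃ a₄ a₆ : ℕ) :
    ∀ x acc : ℕ, legendreCountTR q a₁ a₂ a₃ a₄ a₆ x acc = acc + legendreCountAux q a₁ a₂ a₃ a₄ a₆ x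
  | 0, acc => by simp [legendreCountTR, legendreCountAux]
  | x + 1, acc => by
    rw [legendreCountTR_succ, legendreCountTR_eq q a₁ a₂ a₃ a₄ a₆ x, legendreCountAux]
    omega

/-- **The shallow fast point count** (same value as `legendrePointCount`).
[cite: CremonaAlgorithms1997, §2.4] -/
def legendrePointCountTR (V : WeierstrassCurve ℤ) (q : ℕ) : ℕ :=
  legendreCountTR q (redMod q V.a₁) (redMod q V.a₂) (redMod q V.a₃) (redMod q V.a₄)
    (redMod q V.a₆) q 0 + 1

/-- `legendrePointCountTR = legendrePointCount`. [folklore] -/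
theorem legendrePointCountTR_eq (V : WeierstrassCurve ℤ) (q : ℕ) :
    legendrePointCountTR V q = legendrePointCount V q := by
  rw [legendrePointCountTR, legendrePointCount, legendreCountTR_eq, Nat.zero_add]

/-! ### Shallow killers -/

/-- Good prime, shallow form: `primeTDB q` and `q ∤ Δ`. [cite: CremonaAlgorithms1997, §2.4] -/
def goodPrimeTB (V : WeierstrassCurve ℤ) (q : ℕ) : Bool :=
  primeTDB q && decide (¬ (q : ℤ) ∣ V.Δ)

/-- `goodPrimeTB ⇒ goodPrimeB`. [folklore] -/
theorem goodPrimeB_of_goodPrimeTB (V : WeierstrassCurve ℤ) {q : ℕ} (h : goodPrimeTB V q = true) :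
    goodPrimeB V q = true := by
  rw [goodPrimeTB, Bool.and_eq_true] at h
  rw [goodPrimeB, Bool.and_eq_true, decide_eq_true_eq]
  exact ⟨prime_of_primeTDB h.1, h.2⟩

/-- One kernel-count killer `(ℓ, N)`, shallow form: `ℓ` a good prime (`goodPrimeTB`) and
`#Ẽ(𝔽_ℓ) = N` by `legendrePointCountTR` (`zmodPointCount` at `ℓ = 2`).
[cite: CremonaAlgorithms1997, §2.4] -/
def killerLTB (V : WeierstrassCurve ℤ) : ℕ × ℕ → Bool
  | (0, _) => false
  | (ℓ + 1, N) => goodPrimeTB V (ℓ + 1) &&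
      (if ℓ = 1 then zmodPointCount V (ℓ + 1) == N else legendrePointCountTR V (ℓ + 1) == N)

/-- **`killerLTB ⇒ killerLB`** (same prime, same count). [cite: CremonaAlgorithms1997, §2.4] -/
theorem killerLB_of_killerLTB (V : WeierstrassCurve ℤ) {ℓN : ℕ × ℕ} (h : killerLTB V ℓN = true) :
    killerLB V ℓN = true := by
  obtain ⟨ℓ, N⟩ := ℓN
  cases ℓ with
  | zero => simp [killerLTB] at h
  | succ ℓ =>
    rw [killerLTB, Bool.and_eq_true] at h
    obtain ⟨hgood, hcount⟩ := h
    rw [killerLB, Bool.and_eq_true]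
    refine ⟨goodPrimeB_of_goodPrimeTB V hgood, ?_⟩
    by_cases h1 : ℓ = 1
    · rw [if_pos h1] at hcount ⊢; exact hcount
    · rw [if_neg h1] at hcount ⊢
      rw [legendrePointCountTR_eq] at hcount
      exact hcount

/-- List form: `S.all (killerLTB V) ⇒ S.all (killerLB V)`. [folklore] -/
theorem all_killerLB_of_all_killerLTB (V : WeierstrassCurve ℤ) {S : List (ℕ × ℕ)}
    (h : S.all (killerLTB V) = true) : S.all (killerLB V) = true :=
  List.all_eq_true.mpr fun ℓN hmem => killerLB_of_killerLTB V (List.all_eq_true.mp h ℓN hmem)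

/-! ### The row Boolean, shallow form -/

/-- **The dense row Boolean, shallow kernel form** (kernel `decide`): identical to
`rank3PSatCheckCL` except that the killers of `S` and `Q` are checked by `killerLTB`.
[cite: CremonaAlgorithms1997, §3.5] -/
def rank3PSatCheckCLT (r : Rank3Row) (p : ℕ) (c : Rank3PSatCertC) : Bool :=
  let V := scaleModel r.intModel c.d
  decide (c.d ≠ 0 ∧ V.Δ ≠ 0 ∧ p.Prime ∧ ¬ (p : ℤ) ∣ (c.t : ℤ) ∧
      c.X₁ * r.P₁.2.2 = c.d ^ 2 * r.P₁.1 ∧ c.Y₁ * r.P₁.2.2 = c.d ^ 3 * r.P₁.2.1 ∧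
      c.X₂ * r.P₂.2.2 = c.d ^ 2 * r.P₂.1 ∧ c.Y₂ * r.P₂.2.2 = c.d ^ 3 * r.P₂.2.1 ∧
      c.X₃ * r.P₃.2.2 = c.d ^ 2 * r.P₃.1 ∧ c.Y₃ * r.P₃.2.2 = c.d ^ 3 * r.P₃.2.1 ∧
      c.Y₁ ^ 2 + V.a₁ * c.X₁ * c.Y₁ + V.a₃ * c.Y₁ =
        c.X₁ ^ 3 + V.a₂ * c.X₁ ^ 2 + V.a₄ * c.X₁ + V.a₆ ∧
      c.Y₂ ^ 2 + V.a₁ * c.X₂ * c.Y₂ + V.a₃ * c.Y₂ =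
        c.X₂ ^ 3 + V.a₂ * c.X₂ ^ 2 + V.a₄ * c.X₂ + V.a₆ ∧
      c.Y₃ ^ 2 + V.a₁ * c.X₃ * c.Y₃ + V.a₃ * c.Y₃ =
        c.X₃ ^ 3 + V.a₂ * c.X₃ ^ 2 + V.a₄ * c.X₃ + V.a₆) &&
  annihilatorCheck c.S c.t && c.S.all (killerLTB V) && c.Q.all (killerLTB V) &&
  (normTriples p).all fun abc => c.Q.any (pWitnessC V p c.X₁ c.Y₁ c.X₂ c.Y₂ c.X₃ c.Y₃ abc)

/-- The shallow Boolean implies the fast Boolean (`killerLB_of_killerLTB` on `S` and `Q`).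
[cite: CremonaAlgorithms1997, §3.5] -/
theorem rank3PSatCheckCL_of_checkCLT (r : Rank3Row) (p : ℕ) (c : Rank3PSatCertC)
    (h : rank3PSatCheckCLT r p c = true) : rank3PSatCheckCL r p c = true := by
  unfold rank3PSatCheckCLT at h
  unfold rank3PSatCheckCL
  simp only [Bool.and_eq_true] at h ⊢
  obtain ⟨⟨⟨⟨hdec, hann⟩, hS⟩, hQ⟩, hall⟩ := h
  exact ⟨⟨⟨⟨hdec, hann⟩, all_killerLB_of_all_killerLTB _ hS⟩,
    all_killerLB_of_all_killerLTB _ hQ⟩, hall⟩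

/-- **SOUNDNESS of the shallow dense row certificate**: the listed span
`ℤP₁ + ℤP₂ + ℤP₃ + E(ℚ)_tors` is `p`-SATURATED in `E(ℚ) = r.curve⟮ℚ⟯`.
[cite: CremonaAlgorithms1997, §3.5] -/
theorem Rank3Row.pSaturated_of_pSatCheckCLT (r : Rank3Row) (h : r.check = true) (p : ℕ)
    (c : Rank3PSatCertC) (hc : rank3PSatCheckCLT r p c = true) :
    ∀ a : r.curve.toAffine.Point,
      p • a ∈ AddSubgroup.closure {r.gen₁ h, r.gen₂ h, r.gen₃ h} ⊔ AddCommGroup.torsion _ →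
        a ∈ AddSubgroup.closure {r.gen₁ h, r.gen₂ h, r.gen₃ h} ⊔ AddCommGroup.torsion _ :=
  r.pSaturated_of_pSatCheckCL h p c (rank3PSatCheckCL_of_checkCLT r p c hc)

/-- The shallow Boolean over a list of rows and certificates (same order). [folklore] -/
def rank3PSatCheckCLTAll (p : ℕ) : List Rank3Row → List Rank3PSatCertC → Bool
  | [], _ => true
  | _ :: _, [] => false
  | r :: rs, c :: cs => rank3PSatCheckCLT r p c && rank3PSatCheckCLTAll p rs cs

/-- List form of the reduction to the fast Boolean. [folklore] -/
theorem rank3PSatCheckCLAll_of_checkCLTAll (p : ℕ) :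
    ∀ {rows : List Rank3Row} {cs : List Rank3PSatCertC},
      rank3PSatCheckCLTAll p rows cs = true → rank3PSatCheckCLAll p rows cs = true
  | [], _, _ => by simp [rank3PSatCheckCLAll]
  | _ :: _, [], hc => by simp [rank3PSatCheckCLTAll] at hc
  | r :: rs, c :: cs, hc => by
    rw [rank3PSatCheckCLTAll, Bool.and_eq_true] at hc
    rw [rank3PSatCheckCLAll, Bool.and_eq_true]
    exact ⟨rank3PSatCheckCL_of_checkCLT r p c hc.1, rank3PSatCheckCLAll_of_checkCLTAll p hc.2⟩

/-- **Soundness of the list form, shallow dense certificates** — the statement the `p = 5, 7` data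
files cite. [cite: CremonaAlgorithms1997, §3.5] -/
theorem Rank3Row.pSaturated_of_pSatCheckCLTAll (p : ℕ) {rows : List Rank3Row}
    {cs : List Rank3PSatCertC} (hc : rank3PSatCheckCLTAll p rows cs = true) :
    ∀ r ∈ rows, ∀ h : r.check = true, ∀ a : r.curve.toAffine.Point,
      p • a ∈ AddSubgroup.closure {r.gen₁ h, r.gen₂ h, r.gen₃ h} ⊔ AddCommGroup.torsion _ →
        a ∈ AddSubgroup.closure {r.gen₁ h, r.gen₂ h, r.gen₃ h} ⊔ AddCommGroup.torsion _ :=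
  Rank3Row.pSaturated_of_pSatCheckCLAll p (rank3PSatCheckCLAll_of_checkCLTAll p hc)

end Summit.BirchSwinnertonDyer.BirchSwinnertonDyer.Rank2Observatory
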